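import Summits.ValiantsHypothesis.ValiantsHypothesis.Theorems.KPlusLogSqLawTropicalBBoundarySectorDefs
import Summits.ValiantsHypothesis.ValiantsHypothesis.Theorems.KPlusLogSqLawTropicalBRelabel

/-!
# Route «KPlusLogSqLaw», crux `TropicalB` (stmt-ValiantsHypothesis-19771) — boundary-type sector: RELABELING PLUMBING
# (the first boundary may be taken to be the wrap boundary `[a < b]`) and the reduction of `BoundaryVertexLaw` to an unsigned row bound

HONEST FRAMING.  Helper toward the registered stubs of `Cruxes/TropicalB/Lines/birth.lean` (crux
`Summit.ValiantsHypothesis.ValiantsHypothesis.Theses.KPlusLogSqLaw.TropicalB`, item `stmt-ValiantsHypothesis-19771`, route `KPlusLogSqLaw`,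
DRAFT; cell `pub-symmetroid`, seat val-sym-trop-p1 g2).  Companion of `…TropicalBBoundarySectorDefs` (p447010) and
`…TropicalBBoundarySectorCounting`; plumbing for the trop-p2 successor's target `BoundarySector.BoundaryVertexLaw 2 2` (desk R1474 (a) /
R1476 (a)):

* `BoundarySector.pattern_relabel`, `isBoundaryDesign_relabel` — relabeling rows by `α` and columns by `β` (`ε' a b l = ε (α a) (β b) l`,
  val-sym-trop-p1 g0's `…TropicalBRelabel`) turns a boundary-type design with orders `(π j, ρ j)` into one with orders `(π j * α, ρ j * β)`;
* `BoundarySector.designRowD_boundary_of_canonical` — **WLOG the first boundary is the wrap boundary**: an unsigned row bound proved for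
  all boundary-type designs whose `0`-th orders are the identity (`π 0 = 1`, `ρ 0 = 1`, i.e. pattern bit `0` is `[a < b]`) holds for all
  boundary-type designs (`designRowD_of_relabel` with `α = (π 0)⁻¹`, `β = (ρ 0)⁻¹`);
* `BoundarySector.boundaryVertexLaw_of_designRowD` — an unsigned row bound `DesignRowD … (C·(m+1)^e − 1)` on the sector gives
  `BoundaryVertexLaw B e` (vertex count = longest unsigned chain + 1, `card_dominant_le_succ`); `boundaryVertexLaw_mono` — monotone in `e`.
So the successor may prove `BoundaryVertexLaw 2 2` as: «every two-boundary design with first boundary `[a < b]` has unsigned dominant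
chains of length `< C·(m+1)²`».  Nothing here is in-window; nothing bears on `TropicalB`, `KPlusLogSqLaw`, `Lifting`, DoorA26 / DoorA34,
`MatrixDescartes` (`stmt-ValiantsHypothesis-18050`) or VP ≠ VNP.  [folklore: relabeling invariance of the assignment problem]
-/

-- `Summit.ValiantsHypothesis.ValiantsHypothesis.…` repeats a component by the D-0017 layout
-- (single-conjunct summit), which the `dupNamespace` linter flags; the name is mandated.
set_option linter.dupNamespace false
set_option autoImplicit false

namespace Summit.ValiantsHypothesis.ValiantsHypothesis.Theorems.KPlusLogSqLaw

open Summit.ValiantsHypothesis.ValiantsHypothesis.Theorems.MatrixDescartes.Negative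
open Summit.ValiantsHypothesis.ValiantsHypothesis.Theorems.LacunarySymmetroidMatrixDescartes
open Finset

namespace BoundarySector

variable {m K B : ℕ}

/-- Patterns of the relabeled design: composing the orders with the relabeling. [folklore] -/
theorem pattern_relabel (π ρ : Fin B → Equiv.Perm (Fin m)) (α β : Equiv.Perm (Fin m)) (a b : Fin m) :
    pattern (fun j => π j * α) (fun j => ρ j * β) a b = pattern π ρ (α a) (β b) := by
  funext j
  simp [pattern, Equiv.Perm.mul_apply]

/-- **Relabeling a boundary-type design** (rows by `α`, columns by `β`) gives a boundary-type design with orders `(π j * α, ρ j * β)`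
and the same labelling. [folklore] -/
theorem isBoundaryDesign_relabel {π ρ : Fin B → Equiv.Perm (Fin m)} {lab : (Fin B → Bool) → Fin K}
    {ε : Fin m → Fin m → Fin K → ℤ} (hε : IsBoundaryDesign π ρ lab ε) (α β : Equiv.Perm (Fin m)) :
    IsBoundaryDesign (fun j => π j * α) (fun j => ρ j * β) lab (fun a b l => ε (α a) (β b) l) := by
  intro a b l
  rw [pattern_relabel]
  exact hε (α a) (β b) l

/-- **WLOG the first boundary is the wrap boundary.**  An unsigned row bound `F m` proved for every boundary-type design with `b+1`
boundaries whose `0`-th orders are the identity holds for every boundary-type design with `b+1` boundaries. [folklore] -/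
theorem designRowD_boundary_of_canonical {b : ℕ} (F : ℕ → ℕ)
    (H : ∀ (m K : ℕ) (π ρ : Fin (b + 1) → Equiv.Perm (Fin m)) (lab : (Fin (b + 1) → Bool) → Fin K) (d : Fin K → ℕ)
      (v ε : Fin m → Fin m → Fin K → ℤ), π 0 = 1 → ρ 0 = 1 → IsBoundaryDesign π ρ lab ε → DesignRowD d v ε (F m))
    (m K : ℕ) (π ρ : Fin (b + 1) → Equiv.Perm (Fin m)) (lab : (Fin (b + 1) → Bool) → Fin K) (d : Fin K → ℕ)
    (v ε : Fin m → Fin m → Fin K → ℤ) (hε : IsBoundaryDesign π ρ lab ε) : DesignRowD d v ε (F m) := by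
  -- relabel rows by `(π 0)⁻¹` and columns by `(ρ 0)⁻¹`
  have hrel := isBoundaryDesign_relabel hε (π 0)⁻¹ (ρ 0)⁻¹
  have h0 : (fun j => π j * (π 0)⁻¹) 0 = 1 := by simp
  have h1 : (fun j => ρ j * (ρ 0)⁻¹) 0 = 1 := by simp
  have hrow := H m K (fun j => π j * (π 0)⁻¹) (fun j => ρ j * (ρ 0)⁻¹) lab d
    (fun a c l => v ((π 0)⁻¹ a) ((ρ 0)⁻¹ c) l) (fun a c l => ε ((π 0)⁻¹ a) ((ρ 0)⁻¹ c) l) h0 h1 hrel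
  exact designRowD_of_relabel d v ε (π 0)⁻¹ (ρ 0)⁻¹ hrow

/-- **From an unsigned row bound to the vertex law**: if every boundary-type design with `B` boundaries satisfies
`DesignRowD d v ε (C·(m+1)^e − 1)` then `BoundaryVertexLaw B e` holds with the same constant (for `C ≥ 1`). [folklore] -/
theorem boundaryVertexLaw_of_designRowD {B e : ℕ} (C : ℕ) (hC : 1 ≤ C)
    (H : ∀ (m K : ℕ) (π ρ : Fin B → Equiv.Perm (Fin m)) (lab : (Fin B → Bool) → Fin K) (d : Fin K → ℕ)
      (v ε : Fin m → Fin m → Fin K → ℤ), IsBoundaryDesign π ρ lab ε → DesignRowD d v ε (C * (m + 1) ^ e - 1)) :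
    BoundaryVertexLaw B e := by
  classical
  refine ⟨C, fun m K π ρ lab d v ε hε => ?_⟩
  have h := card_dominant_le_succ d v ε (H m K π ρ lab d v ε hε)
  have hpos : 1 ≤ C * (m + 1) ^ e := Nat.le_trans hC (Nat.le_mul_of_pos_right _ (Nat.one_le_pow _ _ (Nat.succ_pos m)))
  omega

/-- `BoundaryVertexLaw B e` is monotone in the exponent `e`. [folklore] -/
theorem boundaryVertexLaw_mono {B e e' : ℕ} (hee' : e ≤ e') (h : BoundaryVertexLaw B e) : BoundaryVertexLaw B e' := by
  classical
  obtain ⟨C, hC⟩ := h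
  refine ⟨C, fun m K π ρ lab d v ε hε => (hC m K π ρ lab d v ε hε).trans ?_⟩
  exact Nat.mul_le_mul_left C (Nat.pow_le_pow_right (Nat.succ_pos m) hee')

end BoundarySector

end Summit.ValiantsHypothesis.ValiantsHypothesis.Theorems.KPlusLogSqLaw
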